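import Literature.Topology.StoneWeierstrassProduct
import HarnessLib

/-!
# Sums of products `Σ αᵢ(x) βᵢ(y)` with factors in point-separating subalgebras are dense in
# `C(X × Y, ℝ)` (Stone–Weierstrass)

Refinement of `StoneWeierstrassProduct.lean`: if `S_X ⊆ C(X, ℝ)` and `S_Y ⊆ C(Y, ℝ)` are
subalgebras separating the points of the compact spaces `X`, `Y`, then every continuous
`f : X × Y → ℝ` is uniformly approximated by finite sums `Σᵢ αᵢ(x) βᵢ(y)` with `αᵢ ∈ S_X`,
`βᵢ ∈ S_Y` (`exists_sum_mul_near_continuous_of_separatesPoints`). With `S` the smooth functions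
of a compact manifold this produces jointly smooth "tensor" heat flows on `M × M` (Bamler 2020a,
proof of Cor. 3.6). Everything is proved; no definitions, no named facts.

## References

* M. H. Stone, *The generalized Weierstrass approximation theorem*, Math. Mag. 21 (1948).
* R. H. Bamler, *Entropy and heat kernel bounds on a Ricci flow background*, arXiv:2008.07093
  (2020), §3 (proof of Cor. 3.6). [Bamler2020Entropy]
-/

noncomputable section

open Set Filter Topology

namespace Literature.Topology

variable {X Y : Type*} [TopologicalSpace X] [TopologicalSpace Y]

/-- **Sums of products with factors in point-separating subalgebras are uniformly dense in
`C(X × Y, ℝ)`** (`X`, `Y` compact): for continuous `f` and `ε > 0` there are `n`, `αᵢ ∈ S_X`,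
`βᵢ ∈ S_Y` with `|f(x, y) − Σᵢ αᵢ(x) βᵢ(y)| < ε`. [folklore] -/
theorem exists_sum_mul_near_continuous_of_separatesPoints [CompactSpace X] [CompactSpace Y]
    (SX : Subalgebra ℝ C(X, ℝ)) (SY : Subalgebra ℝ C(Y, ℝ)) (hX : SX.SeparatesPoints)
    (hY : SY.SeparatesPoints) {f : X × Y → ℝ} (hf : Continuous f) {ε : ℝ} (hε : 0 < ε) :
    ∃ (n : ℕ) (α : Fin n → C(X, ℝ)) (β : Fin n → C(Y, ℝ)), (∀ i, α i ∈ SX) ∧ (∀ i, β i ∈ SY) ∧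
      ∀ p : X × Y, |f p - ∑ i, α i p.1 * β i p.2| < ε := by
  -- the subalgebra of finite sums of products with factors in `SX`, `SY`
  let A : Subalgebra ℝ C(X × Y, ℝ) :=
    { carrier := {F | ∃ (n : ℕ) (α : Fin n → C(X, ℝ)) (β : Fin n → C(Y, ℝ)),
        (∀ i, α i ∈ SX) ∧ (∀ i, β i ∈ SY) ∧ ∀ p, F p = ∑ i, α i p.1 * β i p.2}
      mul_mem' := by
        rintro F G ⟨n, α, β, hα, hβ, hF⟩ ⟨m, α', β', hα', hβ', hG⟩
        refine ⟨n * m, fun k ↦ α (finProdFinEquiv.symm k).1 * α' (finProdFinEquiv.symm k).2,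
          fun k ↦ β (finProdFinEquiv.symm k).1 * β' (finProdFinEquiv.symm k).2,
          fun k ↦ SX.mul_mem (hα _) (hα' _), fun k ↦ SY.mul_mem (hβ _) (hβ' _), fun p ↦ ?_⟩
        rw [ContinuousMap.mul_apply, hF, hG, Finset.sum_mul_sum, ← Finset.sum_product',
          Finset.univ_product_univ]
        refine Fintype.sum_equiv finProdFinEquiv _ _ fun q ↦ ?_
        simp only [Equiv.symm_apply_apply, ContinuousMap.mul_apply]
        ring
      one_mem' := ⟨1, fun _ ↦ 1, fun _ ↦ 1, fun _ ↦ SX.one_mem, fun _ ↦ SY.one_mem, fun p ↦ by simp⟩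
      add_mem' := by
        rintro F G ⟨n, α, β, hα, hβ, hF⟩ ⟨m, α', β', hα', hβ', hG⟩
        refine ⟨n + m, Fin.append α α', Fin.append β β', fun i ↦ ?_, fun i ↦ ?_, fun p ↦ ?_⟩
        · refine Fin.addCases (fun j ↦ ?_) (fun j ↦ ?_) i <;> simp [hα, hα']
        · refine Fin.addCases (fun j ↦ ?_) (fun j ↦ ?_) i <;> simp [hβ, hβ']
        rw [ContinuousMap.add_apply, hF, hG]
        have := sum_fin_append (fun i ↦ α i p.1 * β i p.2) (fun i ↦ α' i p.1 * β' i p.2)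
        rw [← this]
        refine Finset.sum_congr rfl fun i _ ↦ ?_
        refine Fin.addCases (fun j ↦ ?_) (fun j ↦ ?_) i <;> simp
      zero_mem' := ⟨0, Fin.elim0, Fin.elim0, fun i ↦ i.elim0, fun i ↦ i.elim0, fun p ↦ by simp⟩
      algebraMap_mem' := fun c ↦ ⟨1, fun _ ↦ algebraMap ℝ C(X, ℝ) c, fun _ ↦ 1,
        fun _ ↦ SX.algebraMap_mem c, fun _ ↦ SY.one_mem, fun p ↦ by
          simp [Algebra.algebraMap_eq_smul_one]⟩ }
  -- it separates points
  have hsep : A.SeparatesPoints := by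
    rintro ⟨x, y⟩ ⟨x', y'⟩ hne
    by_cases hx : x = x'
    · subst hx
      have hy : y ≠ y' := fun h ↦ hne (by rw [h])
      obtain ⟨_, ⟨β, hβS, rfl⟩, hβ⟩ := hY hy
      refine ⟨fun p ↦ β p.2, ⟨β.comp ContinuousMap.snd, ⟨1, fun _ ↦ 1, fun _ ↦ β,
        fun _ ↦ SX.one_mem, fun _ ↦ hβS, fun p ↦ by simp⟩, rfl⟩, ?_⟩
      simpa using hβ
    · obtain ⟨_, ⟨α, hαS, rfl⟩, hα⟩ := hX hx
      refine ⟨fun p ↦ α p.1, ⟨α.comp ContinuousMap.fst, ⟨1, fun _ ↦ α, fun _ ↦ 1,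
        fun _ ↦ hαS, fun _ ↦ SY.one_mem, fun p ↦ by simp⟩, rfl⟩, ?_⟩
      simpa using hα
  obtain ⟨g, hg⟩ := ContinuousMap.exists_mem_subalgebra_near_continuous_of_separatesPoints
    A hsep f hf ε hε
  obtain ⟨n, α, β, hα, hβ, hrep⟩ : ∃ (n : ℕ) (α : Fin n → C(X, ℝ)) (β : Fin n → C(Y, ℝ)),
      (∀ i, α i ∈ SX) ∧ (∀ i, β i ∈ SY) ∧ ∀ p, (g : C(X × Y, ℝ)) p = ∑ i, α i p.1 * β i p.2 := g.2
  refine ⟨n, α, β, hα, hβ, fun p ↦ ?_⟩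
  have := hg p
  rw [Real.norm_eq_abs] at this
  rw [abs_sub_comm, ← hrep p]
  exact this

end Literature.Topology

end
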